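import Summits.ResolutionOfSingularities.ResolutionOfSingularities.Theorems.HilbertSamuelEliminationSigmaMaxModificationsCorridor3SigmaStrataLineages
import Summits.ResolutionOfSingularities.ResolutionOfSingularities.Theorems.HilbertSamuelEliminationSigmaMaxModificationsCorridor3SigmaCyclePlusScope
import Summits.ResolutionOfSingularities.ResolutionOfSingularities.Theorems.HilbertSamuelEliminationSigmaMaxModificationsCorridor3WLadderStrataLabels
import HarnessLib

/-!
# [OURS · L1 W4.2] σ-LAYER — Ω-TRANSPORT brick 2: the LABEL CALCULUS over an arbitrary strategy σ and the CYCLE BOOKKEEPING of Ω⁺-runs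
# (treated label, pending length, cycle ends recur, label invariant)

Crux chain w42 (`SigmaMaxModifications`, stmt-ResolutionOfSingularities-18506; conjunct `SigmaMaxModificationsCorridor3`,
stmt-ResolutionOfSingularities-19249), res-L1-w42-plan-1 RULING v3.14-12 (BR-6) / v3.14-14 (DL) «Ω-transports of the W-low rows (4) — 040».
Typer res-type-040 (gen 18). Port of res-L1-w42-stub-4's `…Corridor3WLadderStrataLabels` (p503069) §2–§3: the parts that use only
`Labelling.next` hold for EVERY `Sigma.Strategy` (res-D-pv-047 p519751); the parts that use the cycle discipline (cycle label, pending
length, label invariant) are ported to the END-rule variant Ω⁺ (`IsCanonicalStepΩplus`, p523517). stub-4's strategy-independent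
definitions `treatedLabel`, `pendingLength`, `LabelInv` and their local lemmas are REUSED (they live on `MarkedStage`). NOT ported here
(needs the stronger pending invariant «replayed subscheme ⊆ label part», next brick): the Ω⁺ analogue of `support_eq_part_of_next_none`.
Every `theorem` is PROVED. OURS (cell res-hironaka, slot W4.2); NOT statements of H. Hironaka's manuscript [Hironaka2017] nor of
[CossartJannsenSaito2020]; AI-drafted, weaker than expert review. Helper file `--supports stmt-ResolutionOfSingularities-19249` (counted 0).

Contents (namespace `…Theorems.SigmaMaxModificationsCorridor3.Sigma`): σ-GENERIC `CanonicalNearStepσ.year_eq` / `.label_cases` /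
`.label_le_year`, `StepProjectionσ.year_eq` / `.label_eq_of_mem` / `.mem_componentsIn_of_label_ne`; Ω⁺-SPECIFIC (σ = `Strategy.ofStageOraclePlus ω`)
`lbl_eq_treatedLabel_Ωplus`, `pendingLength_eq_of_succ_Ωplus`, `exists_next_none_Ωplus` (cycle ends recur along infinite Ω⁺-chains),
`treatedLabel_le_of_stepΩplus`, `labelInv_stepΩplus` / `labelInv_of_reachesΩplus`, `labelInv_chainΩplus`.
References: CJS LNM 2270 Rem. 6.29 (1), proof of Thm. 6.28 Step 7 [CossartJannsenSaito2020]; tree `…WLadderStrataLabels` (p503069),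
`…WLadderStrataCentre` (p503885, `exists_next_none`), `…Corridor3SigmaStepDefs` (p519751), `…Corridor3SigmaCyclePlusDefs` (p523517).
-/

noncomputable section

set_option linter.dupNamespace false

open CategoryTheory AlgebraicGeometry TopologicalSpace Topology
open Summit.ResolutionOfSingularities.ResolutionOfSingularities.Theorems.CampaignW42
open Literature.AlgebraicGeometry.Resolution Literature.RingTheory.HilbertSamuel
open Summit.ResolutionOfSingularities.ResolutionOfSingularities.Theorems.SigmaMaxModificationsCorridor3
open Summit.ResolutionOfSingularities.ResolutionOfSingularities.Theorems.SigmaMaxModificationsCorridor3.Moving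

namespace Summit.ResolutionOfSingularities.ResolutionOfSingularities.Theorems.SigmaMaxModificationsCorridor3.Sigma

universe u

variable {σ : Strategy.{u}} {N : ℕ} {ν : ℕ → ℕ} {s s' : MarkedStage.{u}}

/-! ## §1. σ-GENERIC label calculus («dominates ⇒ inherits; otherwise the new year» is strategy-independent) -/

/-- Along a σ-step the year goes up by one. [cite: CossartJannsenSaito2020, Rem. 6.29 (1)] -/
theorem CanonicalNearStepσ.year_eq (h : CanonicalNearStepσ σ N ν s s') : s'.L.year = s.L.year + 1 := by
  obtain ⟨C, P', hln, x', -, -, -, -, rfl⟩ := h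
  rfl

/-- **«Dominates ⇒ inherits; otherwise the new label»** along a σ-step. [cite: CossartJannsenSaito2020, Rem. 6.29 (1)] -/
theorem CanonicalNearStepσ.label_cases (h : CanonicalNearStepσ σ N ν s s') (Z' : Set s'.W) :
    s'.L.label Z' = s.L.year + 1 ∨ ∃ Z ∈ componentsIn (Scheme.hsStratum s.W N ν), s'.L.label Z' = s.L.label Z := by
  obtain ⟨C, P', hln, x', -, -, -, -, rfl⟩ := h
  by_cases hZ : closure (blowup.π C '' Z') ∈ componentsIn (Scheme.hsStratum s.W N ν)
  · exact Or.inr ⟨_, hZ, s.L.next_label_of_mem C hZ⟩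
  · exact Or.inl (s.L.next_label_of_not_mem C hZ)

/-- **Labels stay `≤` year along σ-steps**, for every strategy. [cite: CossartJannsenSaito2020, Rem. 6.29 (1)] -/
theorem CanonicalNearStepσ.label_le_year (h : CanonicalNearStepσ σ N ν s s') (hlab : ∀ Z, s.L.label Z ≤ s.L.year) (Z' : Set s'.W) :
    s'.L.label Z' ≤ s'.L.year := by
  rw [h.year_eq]
  rcases h.label_cases Z' with hnew | ⟨Z, -, hold⟩
  · rw [hnew]
  · rw [hold]
    exact (hlab Z).trans (Nat.le_succ _)

namespace StepProjectionσ

variable {f : s'.W ⟶ s.W}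

/-- The year goes up by one. [folklore] -/
theorem year_eq (hf : StepProjectionσ σ N ν s s' f) : s'.L.year = s.L.year + 1 :=
  hf.canonicalNearStepσ.year_eq

/-- **«Dominates ⇒ inherits»** read through a σ-step projection. [cite: CossartJannsenSaito2020, Rem. 6.29 (1)] -/
theorem label_eq_of_mem (hf : StepProjectionσ σ N ν s s' f) {Z' : Set s'.W}
    (hZ : closure (f.base '' Z') ∈ componentsIn (Scheme.hsStratum s.W N ν)) :
    s'.L.label Z' = s.L.label (closure (f.base '' Z')) := by
  obtain ⟨C, P', hln, x', -, -, -, -, e, rfl⟩ := hf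
  subst e
  simp only [eqToHom_refl, Category.id_comp] at hZ ⊢
  exact s.L.next_label_of_mem C hZ

/-- **«Otherwise it gets the new year»**, contrapositive, through a σ-step projection. [cite: CossartJannsenSaito2020, Rem. 6.29 (1)] -/
theorem mem_componentsIn_of_label_ne (hf : StepProjectionσ σ N ν s s' f) {Z' : Set s'.W}
    (hne : s'.L.label Z' ≠ s.L.year + 1) : closure (f.base '' Z') ∈ componentsIn (Scheme.hsStratum s.W N ν) := by
  obtain ⟨C, P', hln, x', -, -, -, -, e, rfl⟩ := hf
  subst e
  simp only [eqToHom_refl, Category.id_comp]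
  by_contra hZ
  exact hne (s.L.next_label_of_not_mem C hZ)

end StepProjectionσ

/-! ## §2. Ω⁺-SPECIFIC cycle bookkeeping (σ = `Strategy.ofStageOraclePlus ω`) -/

section Omega

variable {ω : StageOracle.{u}}

/-- **Inside an Ω⁺-cycle the label treated is the treated label of the previous stage** (port of `lbl_eq_treatedLabel`).
[cite: CossartJannsenSaito2020, Rem. 6.29 (1), proof of Thm. 6.28 Step 7] -/
theorem lbl_eq_treatedLabel_Ωplus (h : CanonicalNearStepσ (Strategy.ofStageOraclePlus ω) N ν s s') {Q' : Pending s'.W}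
    (h' : s'.P = some Q') : Q'.lbl = treatedLabel N ν s := by
  obtain ⟨C, P', hln, x', hcs, -, -, -, rfl⟩ := h
  change P' = some Q' at h'
  change IsCanonicalStepΩplus ω s.ln N ν s.L s.P C P' at hcs
  rcases hsP : s.P with _ | Q
  · rw [treatedLabel_of_none hsP]
    rw [hsP] at hcs
    obtain ⟨j, hj, hcl, t, -, hrep⟩ := hcs
    rw [hj.csInf_eq]
    cases t with
    | nil _ =>
      obtain ⟨-, hnone⟩ := hrep
      rw [hnone] at h'
      exact absurd h' (by simp)
    | cons D t' =>
      obtain ⟨-, φ', hφ', -, hsome⟩ := (isReplayStepPlus_cons_iff _ _ _ _ D t' C P').mp hrep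
      rw [hsome] at h'
      cases h'
      rfl
  · rw [treatedLabel_of_some hsP]
    rw [hsP] at hcs
    obtain ⟨-, hrep⟩ := hcs
    generalize hr : Q.rest = r at hrep
    cases r with
    | nil _ =>
      obtain ⟨-, hnone⟩ := hrep
      rw [hnone] at h'
      exact absurd h' (by simp)
    | cons D t' =>
      obtain ⟨-, φ', hφ', -, hsome⟩ := (isReplayStepPlus_cons_iff _ _ _ _ D t' C P').mp hrep
      rw [hsome] at h'
      cases h'
      rfl

/-- **Inside an Ω⁺-cycle the pending length drops by one at each step** (port of `pendingLength_eq_of_succ`).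
[cite: CossartJannsenSaito2020, Rem. 6.29 (1)] -/
theorem pendingLength_eq_of_succ_Ωplus (h : CanonicalNearStepσ (Strategy.ofStageOraclePlus ω) N ν s s') {k : ℕ}
    (hk : pendingLength s = k + 1) : pendingLength s' = k := by
  obtain ⟨C, P', hln, x', hcs, -, -, -, rfl⟩ := h
  change IsCanonicalStepΩplus ω s.ln N ν s.L s.P C P' at hcs
  rcases hsP : s.P with _ | Q
  · rw [pendingLength_of_none hsP] at hk
    exact absurd hk (by omega)
  · rw [pendingLength_of_some hsP] at hk
    rw [hsP] at hcs
    obtain ⟨-, hrep⟩ := hcs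
    generalize hr : Q.rest = r at hrep hk
    cases r with
    | nil _ =>
      obtain ⟨-, hnone⟩ := hrep
      have h0 := pendingLength_of_none (s := ⟨blowup C, hln, s.L.next (Scheme.hsStratum s.W N ν) C, P', x'⟩) hnone
      simp only [CentreSeq.length_nil, zero_add] at hk
      omega
    | cons D t' =>
      obtain ⟨-, φ', hφ', -, hsome⟩ := (isReplayStepPlus_cons_iff _ _ _ _ D t' C P').mp hrep
      have h1 := pendingLength_of_some (s := ⟨blowup C, hln, s.L.next (Scheme.hsStratum s.W N ν) C, P', x'⟩) hsome
      dsimp only at h1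
      simp only [CentreSeq.length_cons] at hk
      omega

/-- **Every Ω⁺-cycle ends: along an infinite Ω⁺-chain the state `P = none` recurs** (port of stub-4's `exists_next_none`, p503885).
[cite: CossartJannsenSaito2020, Rem. 6.29 (1)] -/
theorem exists_next_none_Ωplus {c : ℕ → MarkedStage.{u}}
    (hstep : ∀ n, CanonicalNearStepσ (Strategy.ofStageOraclePlus ω) N ν (c n) (c (n + 1))) (n : ℕ) :
    ∃ m, n ≤ m ∧ (c (m + 1)).P = none := by
  have key : ∀ k m, pendingLength (c m) = k → ∃ m', m ≤ m' ∧ (c m').P = none := by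
    intro k
    induction k with
    | zero => exact fun m hm => ⟨m, le_rfl, pendingLength_eq_zero_iff.mp hm⟩
    | succ k ih =>
      intro m hm
      obtain ⟨m', hmm', hP⟩ := ih (m + 1) (pendingLength_eq_of_succ_Ωplus (hstep m) hm)
      exact ⟨m', (Nat.le_succ m).trans hmm', hP⟩
  obtain ⟨m', hm', hP⟩ := key _ (n + 1) rfl
  obtain ⟨m, rfl⟩ : ∃ m, m' = m + 1 := ⟨m' - 1, by omega⟩
  exact ⟨m, by omega, hP⟩

/-- **The treated label does not decrease along an Ω⁺-step** (port of `treatedLabel_le_of_step`).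
[cite: CossartJannsenSaito2020, Rem. 6.29 (1), proof of Thm. 6.28 Step 7] -/
theorem treatedLabel_le_of_stepΩplus (hinv : LabelInv N ν s) (h : CanonicalNearStepσ (Strategy.ofStageOraclePlus ω) N ν s s')
    (hne : (Scheme.hsStratum s'.W N ν).Nonempty) : treatedLabel N ν s ≤ treatedLabel N ν s' := by
  have hneY : (Scheme.hsStratum s.W N ν).Nonempty := by
    obtain ⟨C, P', hln, x', hcs, -, -, -, -⟩ := h
    exact IsCanonicalStepΩplus.hsStratum_nonempty hcs
  rcases hs'P : s'.P with _ | Q'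
  · rw [treatedLabel_of_none hs'P]
    have hS : {i | (s'.L.part (Scheme.hsStratum s'.W N ν) i).Nonempty}.Nonempty := by
      obtain ⟨y, hy⟩ := hne
      obtain ⟨Z', hZ', -⟩ := componentsIn.exists_mem hy
      exact ⟨_, part_label_nonempty s'.L hZ'⟩
    obtain ⟨y, hy⟩ := Nat.sInf_mem hS
    obtain ⟨Z', hZ', hl, -⟩ := (s'.L.mem_part_iff _ _ y).mp hy
    rw [← hl]
    rcases h.label_cases Z' with hnew | ⟨Z, hZ, hold⟩
    · rw [hnew]
      exact (treatedLabel_le_year hinv hneY).trans (Nat.le_succ _)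
    · rw [hold]
      exact treatedLabel_le_label hinv hZ
  · rw [treatedLabel_of_some hs'P, lbl_eq_treatedLabel_Ωplus h hs'P]

/-- **The label invariant propagates along Ω⁺-steps** (port of `LabelInv.step`). [cite: CossartJannsenSaito2020, Rem. 6.29 (1)] -/
theorem labelInv_stepΩplus (hinv : LabelInv N ν s) (h : CanonicalNearStepσ (Strategy.ofStageOraclePlus ω) N ν s s') :
    LabelInv N ν s' := by
  have hneY : (Scheme.hsStratum s.W N ν).Nonempty := by
    obtain ⟨C, P', hln, x', hcs, -, -, -, -⟩ := h
    exact IsCanonicalStepΩplus.hsStratum_nonempty hcs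
  have hyear := h.year_eq
  refine ⟨fun Z' => ?_, fun Q' hQ' Z' hZ' => ?_, fun Q' hQ' => ?_⟩
  · exact h.label_le_year hinv.label_le_year Z'
  · rw [lbl_eq_treatedLabel_Ωplus h hQ']
    rcases h.label_cases Z' with hnew | ⟨Z, hZ, hold⟩
    · rw [hnew]
      exact (treatedLabel_le_year hinv hneY).trans (Nat.le_succ _)
    · rw [hold]
      exact treatedLabel_le_label hinv hZ
  · rw [lbl_eq_treatedLabel_Ωplus h hQ', hyear]
    exact (treatedLabel_le_year hinv hneY).trans (Nat.le_succ _)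

/-- … and along `Reachesσ`. [folklore] -/
theorem labelInv_of_reachesΩplus (hinv : LabelInv N ν s) (hr : Reachesσ (Strategy.ofStageOraclePlus ω) N ν s s') :
    LabelInv N ν s' := by
  induction hr with
  | refl => exact hinv
  | tail _ hlast ih => exact labelInv_stepΩplus ih hlast

/-- The label invariant along an Ω⁺-chain from an initial marked stage. [folklore] -/
theorem labelInv_chainΩplus {X : Scheme.{u}} [IsLocallyNoetherian X] {x : X} {c : ℕ → MarkedStage.{u}}
    (h0 : Reachesσ (Strategy.ofStageOraclePlus ω) N ν (MarkedStage.init X x) (c 0))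
    (hstep : ∀ n, CanonicalNearStepσ (Strategy.ofStageOraclePlus ω) N ν (c n) (c (n + 1))) (n : ℕ) : LabelInv N ν (c n) :=
  labelInv_of_reachesΩplus (labelInv_init (N := N) (ν := ν) X x) (reachesσ_chain h0 hstep n)

end Omega

end Summit.ResolutionOfSingularities.ResolutionOfSingularities.Theorems.SigmaMaxModificationsCorridor3.Sigma

end
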